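import Literature.AnabelianGeometry.EtaleTheta.Discharge.Sec2RigidityProofs

/-!
# [EtTh] Cor 2.18 (iv), fibres — DISCHARGED modulo Prop 2.14 (i) (proof-only companion)

Mochizuki, *The Étale Theta Function …* [EtTh], Publ. RIMS 45 (2009), §2, Cor 2.18 (iv) and its
proof, PRIMS text pp.61–63 (locators `p.N` = PDF pages; bib key `MochizukiEtTh2009`): "the
subgroup of `Ker((Aut^μ(M_N) → Aut^μ(M_M))` … that act trivially on `M_M`" is
"`Hom(Π•_Y/Π•_Ÿ, Ker(Π• ↠ Π•_Y))`".

PROOF-ONLY companion of `ThetaRigidity.lean` (seat abc-iut-L2-t2), unit W2-L2-06 / Cor 2.18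
(abc-iut-L2-t10). Main result `RigidData.cor218_iv_fibre_of_prop214_i`: the named fact
`RigidData.Cor218_iv_fibre` FOLLOWS from the named fact `RigidData.Prop214_i` (Prop 2.14 (i), the
group-theoretic characterisation of `s^alg((l·Δ_Θ)[μ_N])` inside `(Π^tp_Y[μ_N], D_Y)`) and the
interface axiom `RigidData.augYdd_surjective` (the double covering `Ÿ → Y` is geometric, p.41;
added to the interface on this seat's request).

Argument (kernel-checked): an automorphism `α` of the model `M(η)` over the identity of `Π^tp_Y`
(1) maps `μ_N` to itself by some `ψ ∈ Aut(μ_N)`; (2) moves `s^Θ` within its `μ_N`-conjugacy class,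
so `α ∘ s^Θ = conj(c) ∘ s^Θ`; (3) conjugates `D_Y`-automorphisms over `G_K` to such, and fixes
`s^alg(Ker)`, hence preserves the set of Prop 2.14 (i) and with it `s^alg((l·Δ_Θ)[μ_N])`; comparing
`α(s^alg(g)) = ψ(η(g))·η(g)⁻¹·s^alg(g)` on `l·Δ_Θ`, where `η = thetaMod` is onto `μ_N`, gives
`ψ = id`; (4) `α' := conj(c)⁻¹ ∘ α` fixes `μ_N` and `Im(s^Θ)` pointwise, so `α'(s^alg(g)) = φ(g)·s^alg(g)`
for a cocycle `φ` of `Π^tp_Y` vanishing on `Π^tp_Ÿ`; by `augYdd_surjective` and `[Π^tp_Y : Π^tp_Ÿ] = 2`, `φ` is a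
`χ`-invariant homomorphism, and `α = conj(c) ∘ (x ↦ φ(x̄)·x)`. The converse half (twists are
automorphisms) is `ThetaEnvData.exists_iso_eq_twist` (`Sec2RigidityProofs`).
-/

namespace Literature.AnabelianGeometry.EtaleTheta

universe u

/-! ## Transport along an arbitrary self-isomorphism is conjugation in `Out` -/

section TransportConj

variable {A : Type*} [Group A] [TopologicalSpace A]

/-- `TopOut.transport e = conj([e])` for any isomorphism `e` of the topological group with itself.
[cite: MochizukiEtTh2009, Def 2.13(ii) p.47] -/
theorem TopOut.transport_eq_conj (e : A ≃ₜ* A) :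
    TopOut.transport e =
      (MulAut.conj (TopOut.mk A ⟨e.toMulEquiv, e.continuous, e.symm.continuous⟩)).toMonoidHom := by
  refine MonoidHom.ext fun x => ?_
  obtain ⟨φ, rfl⟩ := QuotientGroup.mk_surjective x
  change TopOut.transport _ (TopOut.mk A φ) = TopOut.mk A _ * TopOut.mk A φ * (TopOut.mk A _)⁻¹
  have h : conjContAut e φ =
      (⟨e.toMulEquiv, e.continuous, e.symm.continuous⟩ : contMulAut A) * φ *
        (⟨e.toMulEquiv, e.continuous, e.symm.continuous⟩ : contMulAut A)⁻¹ := by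
    apply Subtype.ext
    apply MulEquiv.ext
    intro x
    rfl
  rw [← map_mul, ← map_inv, ← map_mul, ← h]
  rfl

end TransportConj

namespace RigidData

variable {N : ℕ+} {l : ℕ} (R : RigidData.{u} N l)

/-- `s^alg_Ÿ(g) = η(g) · s^Θ_η(g)` ("by subtracting `η` from `s^alg`", p.46).
[cite: MochizukiEtTh2009, Def 2.13(i) p.47] -/
theorem sAlg_eq_inMu_mul_sTheta {η : R.PiYdd → R.mu} (hη : η ∈ R.thetaCocycles) (g : R.PiYdd) :
    R.toThetaEnvData.sAlg g =
      CycEnvelope.inMu R.augY R.chi (η g) * R.toThetaEnvData.sTheta hη g := by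
  ext
  · simp [ThetaEnvData.sAlg, ThetaEnvData.sTheta]
  · simp [ThetaEnvData.sAlg, ThetaEnvData.sTheta]

/-- Conjugation by an element of the cyclotome fixes every element of `Π^tp_Y[μ_N]` lying over
`Δ^tp_Y = Ker(Π^tp_Y ↠ G_K)` (the cyclotome is central in `Δ_Y[μ_N]`).
[cite: MochizukiEtTh2009, Def 2.10 p.44] -/
theorem conj_inMu_apply_of_augY_eq_one (c : R.mu) (x : R.env) (hx : R.augY x.right = 1) :
    MulAut.conj (CycEnvelope.inMu R.augY R.chi c) x = x := by
  have hx' : R.aug (R.PiY.subtype x.right) = 1 := hx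
  rw [MulAut.conj_apply]
  ext
  · simp only [SemidirectProduct.mul_left, SemidirectProduct.mul_right, SemidirectProduct.inv_left,
      SemidirectProduct.left_inl, SemidirectProduct.right_inl, MonoidHom.coe_comp,
      Function.comp_apply, map_one, MulAut.one_apply, one_mul, hx', inv_one]
    rw [mul_inv_cancel_comm]
  · simp

/-- An automorphism of the model `M(η)` inducing the identity on `Π^tp_Y` moves the theta section
within its `μ_N`-conjugacy class by a CONSTANT: `α ∘ s^Θ_η = conj(c) ∘ s^Θ_η` for some `c ∈ μ_N`
(Def 2.13 (ii)(c)). [cite: MochizukiEtTh2009, Cor 2.18(iv) p.63] -/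
theorem exists_conj_sTheta_of_over_id {η : R.PiYdd → R.mu} (hη : η ∈ R.thetaCocycles)
    (α : (R.modelMono hη).Iso (R.modelMono hη))
    (hα : ∀ x, CycEnvelope.proj R.augY R.chi (α.e x) = CycEnvelope.proj R.augY R.chi x) :
    ∃ c : R.mu, ∀ g, α.e (R.toThetaEnvData.sTheta hη g) =
      MulAut.conj (CycEnvelope.inMu R.augY R.chi c) (R.toThetaEnvData.sTheta hη g) := by
  let A : MulAut R.env := α.e.toMulEquiv
  have hAright : ∀ x, (A x).right = x.right := hα
  have hmem : (R.toThetaEnvData.sTheta hη).range.map A.toMonoidHom ∈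
      CycEnvelope.muConjClass R.augY R.chi (R.toThetaEnvData.sTheta hη).range := by
    have h := α.map_sTheta
    change (fun H : Subgroup R.env => H.map A.toMonoidHom) ''
        CycEnvelope.muConjClass R.augY R.chi (R.toThetaEnvData.sTheta hη).range =
      CycEnvelope.muConjClass R.augY R.chi (R.toThetaEnvData.sTheta hη).range at h
    rw [← h]
    exact ⟨_, CycEnvelope.self_mem_muConjClass _ _ _, rfl⟩
  obtain ⟨c, hc⟩ := hmem
  refine ⟨c, fun g => ?_⟩
  have h1 : A (R.toThetaEnvData.sTheta hη g) ∈ (R.toThetaEnvData.sTheta hη).range.map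
      (MulAut.conj (CycEnvelope.inMu R.augY R.chi c)).toMonoidHom := by
    rw [← hc]; exact ⟨_, ⟨g, rfl⟩, rfl⟩
  obtain ⟨_, ⟨g', rfl⟩, hg'⟩ := h1
  have h2 : (R.inclYdd g' : R.PiY) = R.inclYdd g := by
    have h3 := congrArg SemidirectProduct.right hg'
    rw [MulEquiv.coe_toMonoidHom, hAright] at h3
    simpa [MulAut.conj_apply, ThetaEnvData.sTheta] using h3
  have h4 : g' = g := Subgroup.inclusion_injective R.PiYdd_le h2
  change A _ = _
  rw [← hg', h4]
  rfl

/-- **Key step of Cor 2.18 (iv) (from Prop 2.14 (i))**: an automorphism of the model `M(η)` that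
induces the identity on `Π^tp_Y` FIXES THE CYCLOTOME `μ_N` POINTWISE — it permutes the set
`{γ(β)·β⁻¹·k}` of Prop 2.14 (i), hence preserves `s^alg((l·Δ_Θ)[μ_N])`, on which it acts through
`μ_N` by `ψ(η)·η⁻¹` with `η = thetaMod` onto `μ_N`. [cite: MochizukiEtTh2009, Cor 2.18(iv) p.63] -/
theorem inMu_fixed_of_prop214_i (h214 : R.Prop214_i) {η : R.PiYdd → R.mu}
    (hη : η ∈ R.thetaCocycles) (α : (R.modelMono hη).Iso (R.modelMono hη))
    (hα : ∀ x, CycEnvelope.proj R.augY R.chi (α.e x) = CycEnvelope.proj R.augY R.chi x) :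
    ∀ a : R.mu, α.e (CycEnvelope.inMu R.augY R.chi a) = CycEnvelope.inMu R.augY R.chi a := by
  let A : MulAut R.env := α.e.toMulEquiv
  have hAc : A ∈ contMulAut R.env := ⟨α.e.continuous, α.e.symm.continuous⟩
  have hAproj : ∀ x, CycEnvelope.proj R.augY R.chi (A x) = CycEnvelope.proj R.augY R.chi x := hα
  have hAright : ∀ x, (A x).right = x.right := hα
  have hAinv_right : ∀ x, (A⁻¹ x).right = x.right := fun x => by
    have h := hAright (A⁻¹ x)
    rw [show A (A⁻¹ x) = x from MulEquiv.apply_symm_apply A x] at h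
    exact h.symm
  have hAμ : ∀ a, A (CycEnvelope.inMu R.augY R.chi a) =
      CycEnvelope.inMu R.augY R.chi (A (CycEnvelope.inMu R.augY R.chi a)).left := by
    intro a
    ext
    · simp
    · rw [hAright]; simp
  obtain ⟨c, hAs⟩ := R.exists_conj_sTheta_of_over_id hη α hα
  change ∀ a, A _ = _
  suffices key : ∀ (g : R.PiYdd), (g : R.PiX) ∈ R.lDeltaTheta →
      A (CycEnvelope.inMu R.augY R.chi (η g)) = CycEnvelope.inMu R.augY R.chi (η g) by
    intro a
    obtain ⟨⟨g, hg⟩, hga⟩ := R.thetaMod_surjective a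
    have hgdd : g ∈ R.PiYdd := (R.lDeltaTheta_le hg).1
    have h := key ⟨g, hgdd⟩ hg
    rwa [R.cocycle_lDeltaTheta η hη ⟨g, hgdd⟩ hg, hga] at h
  intro g hg
  have hgS : R.toThetaEnvData.sAlg g ∈ R.algImage R.lDeltaTheta :=
    ⟨g, Subgroup.mem_subgroupOf.mpr hg, rfl⟩
  obtain ⟨γ, ⟨hγc, hγD, hγG⟩, β, hβ, k, ⟨kdd, hkdd', rfl⟩, hdec⟩ := (h214 _).mpr hgS
  have hkdd : (kdd : R.PiX) ∈ R.thetaKer := Subgroup.mem_subgroupOf.mp hkdd'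
  -- `A` fixes `s^alg(Ker)`
  have hηk : η kdd = 1 := R.cocycle_thetaKer η hη kdd hkdd
  have hAk : A (R.toThetaEnvData.sAlg kdd) = R.toThetaEnvData.sAlg kdd := by
    rw [R.sAlg_eq_inMu_mul_sTheta hη, hηk, map_one, one_mul]
    change α.e _ = _
    rw [hAs]
    exact R.conj_inMu_apply_of_augY_eq_one c _ (R.thetaKer_le hkdd).2
  -- `D_Y` is normalised by `[A]`
  have hD : R.DY.map (MulAut.conj (TopOut.mk _ ⟨A, hAc⟩)).toMonoidHom = R.DY := by
    have h := α.map_D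
    change R.DY.map (TopOut.transport α.e) = R.DY at h
    rwa [TopOut.transport_eq_conj] at h
  -- `A γ A⁻¹` is again a `D_Y`-automorphism over `G_K`
  have hγ' : A * γ * A⁻¹ ∈ R.DYAut := by
    refine ⟨Subgroup.mul_mem _ (Subgroup.mul_mem _ hAc hγc) (Subgroup.inv_mem _ hAc), ?_, ?_⟩
    · have h1 : (⟨A * γ * A⁻¹, Subgroup.mul_mem _ (Subgroup.mul_mem _ hAc hγc)
          (Subgroup.inv_mem _ hAc)⟩ : contMulAut R.env) = ⟨A, hAc⟩ * ⟨γ, hγc⟩ * ⟨A, hAc⟩⁻¹ :=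
        Subtype.ext rfl
      rw [h1, map_mul, map_mul, map_inv, ← hD]
      exact ⟨_, hγD, by simp [MulAut.conj_apply]⟩
    · intro x
      change R.augY (CycEnvelope.proj R.augY R.chi (A (γ (A⁻¹ x)))) = _
      rw [hAproj, hγG]
      change R.augY (A⁻¹ x).right = R.augY x.right
      rw [hAinv_right]
  -- `A β ∈ Δ_Y[μ_N]`
  have hβ' : A β ∈ CycEnvelope.deltaEnv R.augY R.chi := by
    rw [CycEnvelope.mem_deltaEnv_iff] at hβ ⊢
    rw [hAright]; exact hβ
  -- apply `A` to the decomposition of `s^alg(g)` and use Prop 2.14 (i) forwards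
  have hdec' : A (R.toThetaEnvData.sAlg g) =
      (A * γ * A⁻¹) (A β) * (A β)⁻¹ * R.toThetaEnvData.sAlg kdd := by
    rw [hdec, map_mul, map_mul, map_inv, hAk]
    congr 2
    change A (γ β) = A (γ (A⁻¹ (A β)))
    rw [show A⁻¹ (A β) = β from MulEquiv.symm_apply_apply A β]
  have hS' : A (R.toThetaEnvData.sAlg g) ∈ R.algImage R.lDeltaTheta :=
    (h214 _).mp ⟨_, hγ', _, hβ', _, ⟨kdd, Subgroup.mem_subgroupOf.mpr hkdd, rfl⟩, hdec'⟩
  obtain ⟨g'', -, hg''⟩ := hS'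
  -- compare the `μ_N`-components
  have hgΔ : R.augY (R.inclYdd g) = 1 := (R.lDeltaTheta_le hg).2
  have h5 : A (R.toThetaEnvData.sAlg g) =
      A (CycEnvelope.inMu R.augY R.chi (η g)) * R.toThetaEnvData.sTheta hη g := by
    rw [R.sAlg_eq_inMu_mul_sTheta hη, map_mul]
    congr 1
    change α.e _ = _
    rw [hAs, R.conj_inMu_apply_of_augY_eq_one c _ hgΔ]
  have h6 := congrArg SemidirectProduct.left (hg''.trans h5)
  simp only [ThetaEnvData.sAlg, ThetaEnvData.sTheta, MonoidHom.coe_comp, Function.comp_apply,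
    SemidirectProduct.left_inr, SemidirectProduct.mul_left, hAright,
    SemidirectProduct.right_inl, map_one, MulAut.one_apply, MonoidHom.coe_mk,
    OneHom.coe_mk] at h6
  rw [hAμ]
  congr 1
  rw [eq_comm, mul_inv_eq_one] at h6
  exact h6

/-- **Cor 2.18 (iv), fibres, DISCHARGED modulo Prop 2.14 (i)**: assuming the named fact
`Prop214_i`, the automorphisms of the model mono-theta environment inducing the identity on
`Π^tp_Y` are, up to `μ_N`-conjugacy, exactly the twists by `Hom(Π^tp_Y/Π^tp_Ÿ, μ_N)` (the
geometricity of `Ÿ → Y`, interface axiom `RigidData.augYdd_surjective`, makes the difference cocycle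
a homomorphism). [cite: MochizukiEtTh2009, Cor 2.18(iv) p.61] -/
theorem cor218_iv_fibre_of_prop214_i (h214 : R.Prop214_i) : R.Cor218_iv_fibre := by
  have hYdd : ∀ h : R.PiY, ∃ d : R.PiYdd, R.augY (R.inclYdd d) = R.augY h := fun h => by
    obtain ⟨d, hd⟩ := R.augYdd_surjective (R.augY h)
    exact ⟨d, hd⟩
  intro η hη
  refine ⟨fun α hα => ?_, fun φ hφ => R.toThetaEnvData.exists_iso_eq_twist hη φ hφ⟩
  let A : MulAut R.env := α.e.toMulEquiv
  have hAe : ∀ x, α.e x = A x := fun x => rfl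
  have hAright : ∀ x, (A x).right = x.right := hα
  obtain ⟨c, hAs'⟩ := R.exists_conj_sTheta_of_over_id hη α hα
  have hAs : ∀ g, A (R.toThetaEnvData.sTheta hη g) =
      MulAut.conj (CycEnvelope.inMu R.augY R.chi c) (R.toThetaEnvData.sTheta hη g) := hAs'
  have hfix : ∀ a : R.mu, A (CycEnvelope.inMu R.augY R.chi a) = CycEnvelope.inMu R.augY R.chi a :=
    R.inMu_fixed_of_prop214_i h214 hη α hα
  -- (4) normalise: `A' := conj(c⁻¹) ∘ A` fixes `μ_N` and `Im(s^Θ)` pointwise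
  let A' : MulAut R.env := MulAut.conj (CycEnvelope.inMu R.augY R.chi c⁻¹) * A
  have hAA' : ∀ x, A x = MulAut.conj (CycEnvelope.inMu R.augY R.chi c) (A' x) := by
    intro x
    change A x = (MulAut.conj (CycEnvelope.inMu R.augY R.chi c) *
      (MulAut.conj (CycEnvelope.inMu R.augY R.chi c⁻¹) * A)) x
    rw [← mul_assoc, ← map_mul, ← map_mul, mul_inv_cancel, map_one, map_one, one_mul]
  have hA'right : ∀ x, (A' x).right = x.right := by
    intro x
    change (MulAut.conj (CycEnvelope.inMu R.augY R.chi c⁻¹) (A x)).right = x.right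
    rw [MulAut.conj_apply]
    simp [hAright]
  have hA'μ : ∀ a, A' (CycEnvelope.inMu R.augY R.chi a) = CycEnvelope.inMu R.augY R.chi a := by
    intro a
    change MulAut.conj (CycEnvelope.inMu R.augY R.chi c⁻¹) (A (CycEnvelope.inMu R.augY R.chi a)) = _
    rw [hfix]
    exact R.conj_inMu_apply_of_augY_eq_one c⁻¹ _ (by simp)
  have hA's : ∀ g, A' (R.toThetaEnvData.sTheta hη g) = R.toThetaEnvData.sTheta hη g := by
    intro g
    change MulAut.conj (CycEnvelope.inMu R.augY R.chi c⁻¹) (A (R.toThetaEnvData.sTheta hη g)) = _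
    rw [hAs, ← MulAut.mul_apply, ← map_mul, ← map_mul, inv_mul_cancel, map_one, map_one,
      MulAut.one_apply]
  -- the function `φ : Π_Y → μ_N`, `A'(s^alg(g)) = (φ g, g)`
  let sY : R.PiY →* R.env := CycEnvelope.algSection R.augY R.chi
  have hsYdd : ∀ d : R.PiYdd, sY (R.inclYdd d) = R.toThetaEnvData.sAlg d := fun d => rfl
  let φf : R.PiY → R.mu := fun g => (A' (sY g)).left
  have hA'sY : ∀ g, A' (sY g) = ⟨φf g, g⟩ := by
    intro g
    ext
    · rfl
    · rw [hA'right]; rfl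
  have hcoc : ∀ g h, φf (g * h) = φf g * R.chi (R.augY g) (φf h) := by
    intro g h
    have h1 := congrArg SemidirectProduct.left
      (show A' (sY (g * h)) = A' (sY g) * A' (sY h) by rw [map_mul, map_mul])
    rw [hA'sY, hA'sY, hA'sY, SemidirectProduct.mul_left] at h1
    simpa only [MonoidHom.coe_comp, Function.comp_apply] using h1
  have hφdd : ∀ d : R.PiYdd, φf (R.inclYdd d) = 1 := by
    intro d
    have h1 : A' (sY (R.inclYdd d)) = sY (R.inclYdd d) := by
      rw [hsYdd, R.sAlg_eq_inMu_mul_sTheta hη, map_mul, hA'μ, hA's]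
    have h2 := congrArg SemidirectProduct.left h1
    rw [hA'sY] at h2
    simpa [sY] using h2
  -- `χ`-invariance of the values of `φ` (uses `[Π_Y : Π_Ÿ] = 2`-normality and `hYdd`)
  have hinv_dd : ∀ (d : R.PiYdd) (h : R.PiY), R.chi (R.augY (R.inclYdd d)) (φf h) = φf h := by
    intro d h
    have h1 : φf (R.inclYdd d * h) = R.chi (R.augY (R.inclYdd d)) (φf h) := by
      rw [hcoc, hφdd, one_mul]
    have hmem : ((h : R.PiX)⁻¹ * (d : R.PiX) * h) ∈ R.PiYdd := by
      have := R.PiYdd_normal.conj_mem _ d.2 (h : R.PiX)⁻¹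
      simpa using this
    have h2 : R.inclYdd d * h = h * R.inclYdd ⟨_, hmem⟩ := by
      apply Subtype.ext
      change (d : R.PiX) * h = h * ((h : R.PiX)⁻¹ * d * h)
      group
    have h3 : φf (h * R.inclYdd ⟨_, hmem⟩) = φf h := by
      rw [hcoc, hφdd, map_one, mul_one]
    rw [← h1, h2, h3]
  have hinv : ∀ g h : R.PiY, R.chi (R.augY g) (φf h) = φf h := by
    intro g h
    obtain ⟨d, hd⟩ := hYdd g
    rw [← hd]
    exact hinv_dd d h
  let φ : R.PiY →* R.mu := MonoidHom.mk' φf (fun g h => by rw [hcoc, hinv])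
  refine ⟨φ, hφdd, c, fun x => ?_⟩
  rw [hAe, hAA']
  congr 1
  calc A' x = A' (CycEnvelope.inMu R.augY R.chi x.left * sY x.right) := by
        rw [CycEnvelope.inMu_mul_algSection]
    _ = CycEnvelope.inMu R.augY R.chi x.left * ⟨φf x.right, x.right⟩ := by
        rw [map_mul, hA'μ, hA'sY]
    _ = CycEnvelope.inMu R.augY R.chi (φ (CycEnvelope.proj R.augY R.chi x)) * x := by
        ext
        · simp only [SemidirectProduct.mul_left, SemidirectProduct.left_inl,
            SemidirectProduct.right_inl, map_one, MulAut.one_apply, φ, MonoidHom.mk'_apply]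
          rw [mul_comm]
          rfl
        · simp

end RigidData

end Literature.AnabelianGeometry.EtaleTheta
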